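import Summits.QuantumFields.YangMills.Theorems.BalabanLadderUVSeamRecTorusLaplaceSU2
import Literature.MathematicalPhysics.QuantumFieldTheory.TorusPlaquetteNeighbours
import Literature.MathematicalPhysics.QuantumFieldTheory.WilsonEnergyConvexity
import Literature.MathematicalPhysics.QuantumFieldTheory.LatticeGaugeProofs
import Mathlib.MeasureTheory.Integral.Marginal
import HarnessLib

/-!
# Crux `UVSeamRec` (stmt-QuantumFields-20043), Tier 2 of the torus thermal ceiling: the UPPER bound on the torus partition function by
# one-link peeling — `∫ e^{−b S} dHaar^E ≤ ψ(b)^{3(M⁴ − M³)}` on the four-torus of side `M`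

Helper file (`--supports stmt-QuantumFields-20043`) of the LEAD seat `ym-spine-20043-p1` (gen 11); sizing of record tempered-d1 g5
`MEMO-D1-g5-coldwall-ceiling.md` §Tier 2 (director-ym R395).  To remove the `log β` of the torus thermal ceiling (`…ThermalCeiling.torusE_plane_ge`:
chord `[0, β]` of the convex `log Z`) one takes the chord `[β/2, β]`, which needs an UPPER bound on `Z(β/2) = ∫ e^{−(β/2)S} dHaar^E` of the right
order `β^{−(3/2)·#dof}`.  This file proves it by **triangular one-link peeling** (general compact `G`, any continuous representation `ρ`):

* §1 `plaquetteHolonomy_update_of_not_mem`, `plaquetteHolonomy_update_third` — updating a link off a plaquette does not move its holonomy; updating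
  the THIRD link `(x + e_l, k)` of the plaquette `(x; k < l)` to `y` gives the holonomy `[U(x,k) U(x+e_k,l)] · y⁻¹ · U(x,l)⁻¹` (torus side `M ≥ 2`);
* §2 `lintegral_boltzmann_conj_inv` — `∫ K_b(a V⁻¹ c) dV = ψ(b) := ∫ K_b(V) dV`, `K_b(g) = exp(−b(N − Re tr ρ g))` (unimodularity and inversion
  invariance of Haar measure); **`lintegral_pi_boltzmann_mul`** — the PEELING STEP: if `g ≥ 0` does not depend on the third link `e` of the plaquette
  `q`, then `∫ K_b(U_q) g(U) dHaar^E(U) = ψ(b) ∫ g dHaar^E` (Fubini through Mathlib's `lmarginal` at the single coordinate `e`);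
* §3 **`lintegral_pi_prod_boltzmann_eq`** — for every finite family `T` of plaquettes with a rank `τ` such that «the third link of `p' ≠ p` lies on
  `p` only if `τ p' < τ p`» (triangularity): `∫ ∏_{p∈T} K_b(U_p) dHaar^E = ψ(b)^{#T}` (peel a plaquette of maximal rank, induct);
* §4 the ELECTRIC FAMILY of the four-torus of side `M`: the plaquettes `(x; k < 3)` with `x₃ ≠ −1` (`electric_triangular`: ranked by `val x₃`, the
  third link of `(x; k, 3)` being the `k`-link at `x + e₃`), of cardinality `3(M⁴ − M³)` (`card_sites_apply_three_ne`, `card_electric`);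
* §5 **`integral_exp_neg_mul_wilsonAction_le_pow`** — dropping the other plaquettes (costs are `≥ 0` for unitary `ρ`):
  `∫ e^{−bS} dHaar^E ≤ ψ(b)^{3(M⁴ − M³)}` (as a real inequality, `ψ` read in `ℝ`), every compact `G`, continuous unitary `ρ`, `b ≥ 0`, `M ≥ 2`;
  **`integral_exp_neg_mul_wilsonAction_le_su2`** — for `SU(2)` fundamental and `b > 0`: `≤ (3/(b√b))^{3(M⁴ − M³)}`
  (`…TorusLaplaceSU2.lintegral_exp_neg_mul_two_sub_trace_le`).

The `3M³` plaquettes `(x; k, 3)` with `x₃ = −1` (whose third links are the temporal "closers") are not peeled: this is the origin of the residual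
`2 log β/(Mβ)` in the final ceiling (the sequel `…TorusCeiling` file).  HONEST FRAMING: a volume-explicit Laplace upper bound for the lattice partition
function; nothing of E0′, NT or the gap; not Clay.
-/

open MeasureTheory Finset Function
open scoped ENNReal Matrix Matrix.Norms.Frobenius
open Literature.MathematicalPhysics.QuantumFieldTheory
open Literature.MathematicalPhysics.QuantumLattice (fundamentalRep fundamentalRep_mem_unitaryGroup continuous_fundamentalRep
  secondCountableTopology_su2)

noncomputable section

namespace Summit.QuantumFields.YangMills.Cruxes.UVSeamRec.ClassicalResponse.ThermalFloor

/-! ### §1 Updating one link of a plaquette -/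

section Holonomy

variable {M : ℕ} {G : Type*} [Group G]

/-- Updating a link which is not an edge of the plaquette `q` does not change the holonomy of `q`. [folklore] -/
theorem plaquetteHolonomy_update_of_not_mem (q : Plaquette 4 M) {e : Edge 4 M} (he : e ∉ plaqEdgesT q)
    (U : GaugeConfig 4 M G) (y : G) :
    plaquetteHolonomy (Function.update U e y) q.1 q.2.1.1 q.2.1.2 = plaquetteHolonomy U q.1 q.2.1.1 q.2.1.2 :=
  dependsOn_plaquetteHolonomy q (fun _ he' => Function.update_of_ne (ne_of_mem_of_not_mem he' he) _ _)

/-- On a torus of side `M ≥ 2` a site is not its own neighbour: `x + e_l ≠ x`. [folklore] -/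
theorem shift_ne_self [Fact (1 < M)] (x : Site 4 M) (l : Fin 4) : x.shift l ≠ x := by
  intro h
  have h1 : (Pi.single l (1 : ZMod M) : Site 4 M) = 0 := by
    have : x + Pi.single l 1 = x + 0 := by rw [add_zero]; exact h
    exact add_left_cancel this
  have h2 := congrFun h1 l
  simp at h2

/-- **Updating the THIRD link.**  For the plaquette `q = (x; k < l)` of a torus of side `M ≥ 2`, updating its third link `(x + e_l, k)` to `y` gives the
holonomy `U(x,k) U(x+e_k,l) · y⁻¹ · U(x,l)⁻¹` (the other three edges are different links). [folklore] -/
theorem plaquetteHolonomy_update_third [Fact (1 < M)] (q : Plaquette 4 M) (U : GaugeConfig 4 M G) (y : G) :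
    plaquetteHolonomy (Function.update U (q.1.shift q.2.1.2, q.2.1.1) y) q.1 q.2.1.1 q.2.1.2 =
      U (q.1, q.2.1.1) * U (q.1.shift q.2.1.1, q.2.1.2) * y⁻¹ * (U (q.1, q.2.1.2))⁻¹ := by
  have hkl : q.2.1.1 ≠ q.2.1.2 := q.2.2.ne
  have h1 : (q.1, q.2.1.1) ≠ (q.1.shift q.2.1.2, q.2.1.1) := fun h => shift_ne_self q.1 q.2.1.2 (Prod.mk.inj h).1.symm
  have h2 : (q.1.shift q.2.1.1, q.2.1.2) ≠ (q.1.shift q.2.1.2, q.2.1.1) := fun h => hkl.symm (Prod.mk.inj h).2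
  have h3 : (q.1, q.2.1.2) ≠ (q.1.shift q.2.1.2, q.2.1.1) := fun h => hkl.symm (Prod.mk.inj h).2
  unfold plaquetteHolonomy
  rw [Function.update_of_ne h1, Function.update_of_ne h2, Function.update_of_ne h3, Function.update_self]

end Holonomy

/-! ### §2 The one-link integral and the peeling step -/

section Peeling

variable {M N : ℕ} [NeZero M] {G : Type*} [Group G] [TopologicalSpace G] [IsTopologicalGroup G] [CompactSpace G]
  [MeasurableSpace G] [BorelSpace G] [SecondCountableTopology G] (ρ : G →* Matrix (Fin N) (Fin N) ℂ)

omit [NeZero M] [CompactSpace G] in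
/-- The Boltzmann factor of one plaquette is measurable in the configuration (continuous `ρ`). [folklore] -/
theorem measurable_boltzmann_plaquette (hρ : Continuous ρ) (b : ℝ) (q : Plaquette 4 M) :
    Measurable fun U : GaugeConfig 4 M G =>
      ENNReal.ofReal (Real.exp (-(b * ((N : ℝ) - (ρ (plaquetteHolonomy U q.1 q.2.1.1 q.2.1.2)).trace.re)))) := by
  have hc : Continuous fun g : G => (N : ℝ) - (ρ g).trace.re :=
    continuous_const.sub (Complex.continuous_re.comp ((Continuous.matrix_trace hρ)))
  exact ENNReal.measurable_ofReal.comp (Real.measurable_exp.comp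
    ((hc.measurable.comp (measurable_plaquetteHolonomy q.1 q.2.1.1 q.2.1.2)).const_mul b).neg)

omit [NeZero M] [SecondCountableTopology G] in
/-- **The one-link integral is translation- and inversion-invariant**: `∫ K_b(a V⁻¹ c) dV = ∫ K_b(V) dV =: ψ(b)` on the compact group `G`
(`K_b(g) = exp(−b(N − Re tr ρ g))`). [folklore] -/
theorem lintegral_boltzmann_conj_inv (b : ℝ) (a c : G) :
    ∫⁻ V, ENNReal.ofReal (Real.exp (-(b * ((N : ℝ) - (ρ (a * V⁻¹ * c)).trace.re)))) ∂(haarProbability G) =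
      ∫⁻ V, ENNReal.ofReal (Real.exp (-(b * ((N : ℝ) - (ρ V).trace.re)))) ∂(haarProbability G) := by
  set φ : G → ℝ≥0∞ := fun V => ENNReal.ofReal (Real.exp (-(b * ((N : ℝ) - (ρ V).trace.re)))) with hφ
  show ∫⁻ V, φ (a * V⁻¹ * c) ∂(haarProbability G) = ∫⁻ V, φ V ∂(haarProbability G)
  have hinv := lintegral_inv_eq_self (μ := haarProbability G) (fun V => φ (a * V * c))
  rw [hinv]
  have hl := lintegral_mul_left_eq_self (μ := haarProbability G) (fun V => φ (V * c)) a
  rw [hl]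
  exact lintegral_mul_right_eq_self φ c

/-- **THE PEELING STEP.**  On a torus of side `M ≥ 2`, let `q` be a plaquette with third link `e = (x + e_l, k)` and `g ≥ 0` a measurable function of
the configuration NOT depending on the link `e`.  Then `∫ K_b(U_q) g(U) dHaar^E(U) = ψ(b) · ∫ g dHaar^E` (`ψ(b) = ∫ K_b dHaar`): integrate the
coordinate `e` first (Mathlib's `lmarginal` at `{e}`), where `U_q = A y⁻¹ B` with `A, B, g` frozen. [folklore] -/
theorem lintegral_pi_boltzmann_mul [Fact (1 < M)] (hρ : Continuous ρ) (b : ℝ) (q : Plaquette 4 M)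
    {g : GaugeConfig 4 M G → ℝ≥0∞} (hg : Measurable g)
    (hge : ∀ (U : GaugeConfig 4 M G) (y : G), g (Function.update U (q.1.shift q.2.1.2, q.2.1.1) y) = g U) :
    ∫⁻ U, ENNReal.ofReal (Real.exp (-(b * ((N : ℝ) - (ρ (plaquetteHolonomy U q.1 q.2.1.1 q.2.1.2)).trace.re)))) * g U
        ∂(Measure.pi fun _ : Edge 4 M => haarProbability G) =
      (∫⁻ V, ENNReal.ofReal (Real.exp (-(b * ((N : ℝ) - (ρ V).trace.re)))) ∂(haarProbability G)) *
        ∫⁻ U, g U ∂(Measure.pi fun _ : Edge 4 M => haarProbability G) := by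
  classical
  set e : Edge 4 M := (q.1.shift q.2.1.2, q.2.1.1) with he
  set K : G → ℝ≥0∞ := fun V => ENNReal.ofReal (Real.exp (-(b * ((N : ℝ) - (ρ V).trace.re)))) with hK
  set ψ : ℝ≥0∞ := ∫⁻ V, K V ∂(haarProbability G) with hψ
  have hKm : Measurable K := by
    have hc : Continuous fun g : G => (N : ℝ) - (ρ g).trace.re :=
      continuous_const.sub (Complex.continuous_re.comp ((Continuous.matrix_trace hρ)))
    exact ENNReal.measurable_ofReal.comp (Real.measurable_exp.comp ((hc.measurable).const_mul b).neg)
  set f : GaugeConfig 4 M G → ℝ≥0∞ := fun U => K (plaquetteHolonomy U q.1 q.2.1.1 q.2.1.2) * g U with hf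
  have hfm : Measurable f := (hKm.comp (measurable_plaquetteHolonomy q.1 q.2.1.1 q.2.1.2)).mul hg
  have hcm : Measurable fun U : GaugeConfig 4 M G => ψ * g U := hg.const_mul ψ
  -- the two functions have the same marginal at `{e}`
  have hmarg : ∫⋯∫⁻_{e}, f ∂(fun _ : Edge 4 M => haarProbability G) =
      ∫⋯∫⁻_{e}, (fun U => ψ * g U) ∂(fun _ : Edge 4 M => haarProbability G) := by
    rw [lmarginal_singleton, lmarginal_singleton]
    funext U
    have h1 : ∀ y : G, f (Function.update U e y) =
        K (U (q.1, q.2.1.1) * U (q.1.shift q.2.1.1, q.2.1.2) * y⁻¹ * (U (q.1, q.2.1.2))⁻¹) * g U := by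
      intro y
      simp only [hf, he]
      rw [plaquetteHolonomy_update_third q U y, hge U y]
    have h2 : ∀ y : G, (fun U => ψ * g U) (Function.update U e y) = ψ * g U := by
      intro y
      show ψ * g (Function.update U e y) = ψ * g U
      rw [he, hge U y]
    simp_rw [h1, h2]
    have hmeas : Measurable (fun y : G => K (U (q.1, q.2.1.1) * U (q.1.shift q.2.1.1, q.2.1.2) * y⁻¹ * (U (q.1, q.2.1.2))⁻¹)) :=
      hKm.comp ((measurable_const.mul measurable_inv).mul measurable_const)
    have hconj : ∫⁻ y, K (U (q.1, q.2.1.1) * U (q.1.shift q.2.1.1, q.2.1.2) * y⁻¹ * (U (q.1, q.2.1.2))⁻¹) ∂(haarProbability G) = ψ :=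
      lintegral_boltzmann_conj_inv ρ b _ _
    rw [lintegral_mul_const _ hmeas, lintegral_const, measure_univ, mul_one, hconj, mul_comm]
  have h := lintegral_eq_of_lmarginal_eq (μ := fun _ : Edge 4 M => haarProbability G) {e} hfm hcm hmarg
  rw [hf] at h
  rw [h, lintegral_const_mul _ hg]

/-! ### §3 Triangular families peel completely -/

/-- **Triangular families of plaquettes peel completely.**  On a torus of side `M ≥ 2`, let `T` be a finite family of plaquettes and `τ` a rank with the
TRIANGULARITY property: whenever the third link of `p' ∈ T` is an edge of `p ∈ T`, `p' ≠ p`, then `τ p' < τ p`.  Then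
`∫ ∏_{p∈T} K_b(U_p) dHaar^E = ψ(b)^{#T}` — peel a plaquette of maximal rank (its third link lies on no other member) and induct. [folklore] -/
theorem lintegral_pi_prod_boltzmann_eq [Fact (1 < M)] (hρ : Continuous ρ) (b : ℝ) (τ : Plaquette 4 M → ℕ) (T : Finset (Plaquette 4 M))
    (htri : ∀ p ∈ T, ∀ p' ∈ T, p' ≠ p → (p'.1.shift p'.2.1.2, p'.2.1.1) ∈ plaqEdgesT p → τ p' < τ p) :
    ∫⁻ U, ∏ p ∈ T, ENNReal.ofReal (Real.exp (-(b * ((N : ℝ) - (ρ (plaquetteHolonomy U p.1 p.2.1.1 p.2.1.2)).trace.re))))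
        ∂(Measure.pi fun _ : Edge 4 M => haarProbability G) =
      (∫⁻ V, ENNReal.ofReal (Real.exp (-(b * ((N : ℝ) - (ρ V).trace.re)))) ∂(haarProbability G)) ^ T.card := by
  classical
  set K : G → ℝ≥0∞ := fun V => ENNReal.ofReal (Real.exp (-(b * ((N : ℝ) - (ρ V).trace.re)))) with hK
  -- induction on the cardinality
  induction' hn : T.card with n ih generalizing T
  · rw [Finset.card_eq_zero.1 hn]
    simp
  · -- a member of maximal rank
    have hne : T.Nonempty := by rw [← Finset.card_pos, hn]; exact Nat.succ_pos n
    obtain ⟨p₀, hp₀, hmax⟩ := T.exists_max_image τ hne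
    set e₀ : Edge 4 M := (p₀.1.shift p₀.2.1.2, p₀.2.1.1) with he₀
    -- its third link lies on no other member of `T`
    have hfree : ∀ p ∈ T.erase p₀, e₀ ∉ plaqEdgesT p := by
      intro p hp hmem
      have hpT : p ∈ T := Finset.mem_of_mem_erase hp
      have hne' : p₀ ≠ p := (Finset.ne_of_mem_erase hp).symm
      have hlt := htri p hpT p₀ hp₀ hne' hmem
      exact absurd (hmax p hpT) (not_le.2 hlt)
    set g : GaugeConfig 4 M G → ℝ≥0∞ :=
      fun U => ∏ p ∈ T.erase p₀, K (plaquetteHolonomy U p.1 p.2.1.1 p.2.1.2) with hg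
    have hgm : Measurable g :=
      Finset.measurable_prod _ fun p _ => measurable_boltzmann_plaquette ρ hρ b p
    have hge : ∀ (U : GaugeConfig 4 M G) (y : G), g (Function.update U e₀ y) = g U := by
      intro U y
      show (∏ p ∈ T.erase p₀, K (plaquetteHolonomy (Function.update U e₀ y) p.1 p.2.1.1 p.2.1.2)) =
        ∏ p ∈ T.erase p₀, K (plaquetteHolonomy U p.1 p.2.1.1 p.2.1.2)
      refine Finset.prod_congr rfl fun p hp => ?_
      rw [plaquetteHolonomy_update_of_not_mem p (hfree p hp) U y]
    have hsplit : ∀ U : GaugeConfig 4 M G,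
        ∏ p ∈ T, K (plaquetteHolonomy U p.1 p.2.1.1 p.2.1.2) = K (plaquetteHolonomy U p₀.1 p₀.2.1.1 p₀.2.1.2) * g U :=
      fun U => (Finset.mul_prod_erase T (fun p => K (plaquetteHolonomy U p.1 p.2.1.1 p.2.1.2)) hp₀).symm
    show ∫⁻ U, ∏ p ∈ T, K (plaquetteHolonomy U p.1 p.2.1.1 p.2.1.2) ∂(Measure.pi fun _ : Edge 4 M => haarProbability G) =
      (∫⁻ V, K V ∂(haarProbability G)) ^ (n + 1)
    simp_rw [hsplit]
    rw [lintegral_pi_boltzmann_mul ρ hρ b p₀ hgm hge]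
    have hcard : (T.erase p₀).card = n := by rw [Finset.card_erase_of_mem hp₀, hn]; rfl
    have htri' : ∀ p ∈ T.erase p₀, ∀ p' ∈ T.erase p₀, p' ≠ p → (p'.1.shift p'.2.1.2, p'.2.1.1) ∈ plaqEdgesT p → τ p' < τ p :=
      fun p hp p' hp' => htri p (Finset.mem_of_mem_erase hp) p' (Finset.mem_of_mem_erase hp')
    rw [ih (T.erase p₀) htri' hcard, pow_succ, mul_comm]

end Peeling

/-! ### §4 The electric family of the four-torus -/

section Electric

variable {M : ℕ} [NeZero M]

/-- The number of sites of the four-torus of side `M` with prescribed last coordinate is `M³`. [folklore] -/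
theorem card_sites_apply_three_eq (c : ZMod M) :
    (univ.filter fun x : Site 4 M => x 3 = c).card = M ^ 3 := by
  classical
  have h3 : (3 : Fin 4) = Fin.last 3 := rfl
  have himg : (univ.filter fun x : Site 4 M => x 3 = c) =
      (univ : Finset (Fin 3 → ZMod M)).image (fun v => (Fin.snoc v c : Site 4 M)) := by
    ext x
    simp only [mem_filter, mem_univ, true_and, mem_image]
    constructor
    · intro hx
      refine ⟨Fin.init x, ?_⟩
      have := Fin.snoc_init_self x
      rw [h3] at hx
      rw [← hx]
      exact this
    · rintro ⟨v, rfl⟩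
      rw [h3]
      exact Fin.snoc_last (α := fun _ : Fin 4 => ZMod M) (x := c) (p := v)
  rw [himg, card_image_of_injective _ (fun v w h => by simpa using Fin.snoc_injective2 h)]
  simp [ZMod.card]

/-- The number of sites of the four-torus of side `M` whose last coordinate is NOT `−1` is `M⁴ − M³`. [folklore] -/
theorem card_sites_apply_three_ne :
    (univ.filter fun x : Site 4 M => x 3 ≠ -1).card = M ^ 4 - M ^ 3 := by
  classical
  have h := Finset.card_filter_add_card_filter_not (s := (univ : Finset (Site 4 M))) (fun x : Site 4 M => x 3 = -1)
  rw [card_sites_apply_three_eq, Finset.card_univ] at h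
  have hu : Fintype.card (Site 4 M) = M ^ 4 := by simp [ZMod.card]
  rw [hu] at h
  have h' : (univ.filter fun x : Site 4 M => ¬x 3 = -1).card = M ^ 4 - M ^ 3 := by omega
  convert h' using 2

/-- The rank of the electric family: `val x₃` increases by one along `e₃` off the slice `x₃ = −1`. [folklore] -/
theorem val_apply_three_shift [Fact (1 < M)] {x : Site 4 M} (hx : x 3 ≠ -1) :
    ((x.shift 3) 3).val = (x 3).val + 1 := by
  have hlt : (x 3).val + 1 < M := by
    have h1 : (x 3).val < M := ZMod.val_lt _
    rcases Nat.lt_or_ge ((x 3).val + 1) M with h | h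
    · exact h
    · exfalso
      have hv : (x 3).val = M - 1 := by omega
      obtain ⟨m, hm⟩ : ∃ m, M = m + 1 := ⟨M - 1, by have := NeZero.pos M; omega⟩
      subst hm
      have hneg : ((-1 : ZMod (m + 1))).val = m := ZMod.val_neg_one m
      apply hx
      apply ZMod.val_injective
      rw [hv, hneg]; rfl
  have : (x.shift 3) 3 = x 3 + 1 := by simp [Site.shift]
  rw [this, ZMod.val_add_of_lt (by rwa [ZMod.val_one]), ZMod.val_one]

/-- **The electric family is triangular.**  For plaquettes `p = (x; k, 3)`, `p' = (x'; k', 3)` (`k, k' < 3`) of a torus of side `M ≥ 2` with `x'₃ ≠ −1`: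
if the third link `(x' + e₃, k')` of `p'` is an edge of `p` and `p' ≠ p`, then `val x'₃ < val x₃` (it must be the first edge `(x, k)` of `p`, so
`x = x' + e₃`). [folklore] -/
theorem electric_triangular [Fact (1 < M)] {x x' : Site 4 M} {k k' : Fin 3} (hx' : x' 3 ≠ -1)
    (hne : (⟨x', ⟨(k'.castSucc, 3), Fin.castSucc_lt_last k'⟩⟩ : Plaquette 4 M) ≠ ⟨x, ⟨(k.castSucc, 3), Fin.castSucc_lt_last k⟩⟩)
    (hmem : (x'.shift 3, k'.castSucc) ∈ plaqEdgesT (⟨x, ⟨(k.castSucc, 3), Fin.castSucc_lt_last k⟩⟩ : Plaquette 4 M)) :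
    (x' 3).val < (x 3).val := by
  have hk3 : k'.castSucc ≠ (3 : Fin 4) := (Fin.castSucc_lt_last k').ne
  simp only [plaqEdgesT, mem_insert, mem_singleton, Prod.mk.injEq] at hmem
  rcases hmem with ⟨h1, h2⟩ | ⟨_, h2⟩ | ⟨h1, h2⟩ | ⟨_, h2⟩
  · -- the first edge `(x, k)`: `x = x' + e₃`
    rw [← h1, val_apply_three_shift hx']
    exact Nat.lt_succ_self _
  · exact absurd h2 hk3
  · -- the third edge of `p` itself: then `p' = p`
    exfalso
    apply hne
    have hx : x' = x := by
      have := congrArg (fun z : Site 4 M => z - Pi.single (3 : Fin 4) 1) h1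
      simpa [Site.shift] using this
    have hk : k' = k := Fin.castSucc_injective _ h2
    subst hx; subst hk; rfl
  · exact absurd h2 hk3

/-- The electric plaquette `(x; k, 3)` attached to the site `x` and the spatial direction `k < 3`. (Inline description; the family is the image of
`{x : x₃ ≠ −1} × Fin 3`.) [folklore] -/
theorem card_electric :
    (((univ.filter fun x : Site 4 M => x 3 ≠ -1) ×ˢ (univ : Finset (Fin 3))).image
        (fun xk : Site 4 M × Fin 3 => (⟨xk.1, ⟨(xk.2.castSucc, 3), Fin.castSucc_lt_last xk.2⟩⟩ : Plaquette 4 M))).card =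
      3 * (M ^ 4 - M ^ 3) := by
  classical
  rw [card_image_of_injective, card_product, card_sites_apply_three_ne, Finset.card_univ, Fintype.card_fin, mul_comm]
  rintro ⟨x, k⟩ ⟨x', k'⟩ h
  simp only [Prod.mk.injEq] at h ⊢
  obtain ⟨h1, h2⟩ := h
  have h2' := congrArg (fun z : {p : Fin 4 × Fin 4 // p.1 < p.2} => z.1.1) h2
  exact ⟨h1, Fin.castSucc_injective _ h2'⟩

end Electric

/-! ### §5 The upper bound on the partition function -/

section Upper

variable {M N : ℕ} [NeZero M] {G : Type*} [Group G] [TopologicalSpace G] [IsTopologicalGroup G] [CompactSpace G]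
  [MeasurableSpace G] [BorelSpace G] [SecondCountableTopology G] (ρ : G →* Matrix (Fin N) (Fin N) ℂ)

/-- **UPPER BOUND ON THE TORUS PARTITION FUNCTION by peeling the electric family.**  For a compact second-countable `G`, a continuous unitary
representation `ρ`, `b ≥ 0` and a four-torus of side `M ≥ 2`:
`∫ exp(−b S) dHaar^E ≤ ψ(b)^{3(M⁴ − M³)}`, `ψ(b) = ∫ exp(−b(N − Re tr ρ V)) dHaar(V)` — drop the non-electric plaquettes (their costs are `≥ 0`) and
peel the electric family completely (`lintegral_pi_prod_boltzmann_eq`). [folklore] -/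
theorem integral_exp_neg_mul_wilsonAction_le_pow [Fact (1 < M)] (hρ : Continuous ρ) (hρU : ∀ g, ρ g ∈ Matrix.unitaryGroup (Fin N) ℂ)
    {b : ℝ} (hb : 0 ≤ b) :
    ∫ U, Real.exp (-b * wilsonAction ρ U) ∂(Measure.pi fun _ : Edge 4 M => haarProbability G) ≤
      (∫⁻ V, ENNReal.ofReal (Real.exp (-(b * ((N : ℝ) - (ρ V).trace.re)))) ∂(haarProbability G)).toReal ^ (3 * (M ^ 4 - M ^ 3)) := by
  classical
  set π₀ : Measure (GaugeConfig 4 M G) := Measure.pi fun _ : Edge 4 M => haarProbability G with hπ₀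
  set K : G → ℝ≥0∞ := fun V => ENNReal.ofReal (Real.exp (-(b * ((N : ℝ) - (ρ V).trace.re)))) with hK
  set S : Finset (Plaquette 4 M) := ((univ.filter fun x : Site 4 M => x 3 ≠ -1) ×ˢ (univ : Finset (Fin 3))).image
      (fun xk : Site 4 M × Fin 3 => (⟨xk.1, ⟨(xk.2.castSucc, 3), Fin.castSucc_lt_last xk.2⟩⟩ : Plaquette 4 M)) with hS
  have hScard : S.card = 3 * (M ^ 4 - M ^ 3) := card_electric
  -- triangularity of `S` for the rank `val x₃`
  have htri : ∀ p ∈ S, ∀ p' ∈ S, p' ≠ p → (p'.1.shift p'.2.1.2, p'.2.1.1) ∈ plaqEdgesT p →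
      (fun p : Plaquette 4 M => (p.1 3).val) p' < (fun p : Plaquette 4 M => (p.1 3).val) p := by
    intro p hp p' hp' hne hmem
    simp only [hS, mem_image, mem_product, mem_filter, mem_univ, true_and, and_true] at hp hp'
    obtain ⟨⟨x, k⟩, hx, rfl⟩ := hp
    obtain ⟨⟨x', k'⟩, hx', rfl⟩ := hp'
    exact electric_triangular hx' hne hmem
  have hpeel := lintegral_pi_prod_boltzmann_eq ρ hρ b (fun p : Plaquette 4 M => (p.1 3).val) S htri
  -- pointwise: `exp(−bS) ≤ ∏_{p∈S} exp(−b cost_p)`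
  have hcost0 : ∀ (U : GaugeConfig 4 M G) (p : Plaquette 4 M),
      0 ≤ (N : ℝ) - (ρ (plaquetteHolonomy U p.1 p.2.1.1 p.2.1.2)).trace.re := by
    intro U p
    rw [sub_re_trace_eq_half_norm_sub_one_sq (hρU _)]
    positivity
  have hpt : ∀ U : GaugeConfig 4 M G, ENNReal.ofReal (Real.exp (-b * wilsonAction ρ U)) ≤
      ∏ p ∈ S, K (plaquetteHolonomy U p.1 p.2.1.1 p.2.1.2) := by
    intro U
    have hsum : ∑ p ∈ S, ((N : ℝ) - (ρ (plaquetteHolonomy U p.1 p.2.1.1 p.2.1.2)).trace.re) ≤ wilsonAction ρ U := by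
      unfold wilsonAction
      exact Finset.sum_le_sum_of_subset_of_nonneg (Finset.subset_univ S) fun p _ _ => hcost0 U p
    simp only [hK]
    rw [← ENNReal.ofReal_prod_of_nonneg (fun p _ => (Real.exp_pos _).le), ← Real.exp_sum]
    refine ENNReal.ofReal_le_ofReal (Real.exp_le_exp.2 ?_)
    rw [Finset.sum_neg_distrib, ← Finset.mul_sum, neg_mul]
    exact neg_le_neg (mul_le_mul_of_nonneg_left hsum hb)
  -- integrate
  have hint : Integrable (fun U => Real.exp (-b * wilsonAction ρ U)) π₀ := integrable_exp_mul_wilsonAction ρ hρ (-b) π₀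
  have hI : ENNReal.ofReal (∫ U, Real.exp (-b * wilsonAction ρ U) ∂π₀) ≤ (∫⁻ V, K V ∂(haarProbability G)) ^ S.card := by
    rw [ofReal_integral_eq_lintegral_ofReal hint (ae_of_all _ fun U => (Real.exp_pos _).le), ← hpeel]
    exact lintegral_mono hpt
  -- `ψ ≤ 1 < ⊤`
  haveI : IsProbabilityMeasure (haarProbability G) :=
    ⟨by simpa [haarProbability] using Measure.haarMeasure_self (G := G) (K₀ := ⊤)⟩
  have hψle : ∫⁻ V, K V ∂(haarProbability G) ≤ 1 := by
    calc ∫⁻ V, K V ∂(haarProbability G) ≤ ∫⁻ _V, 1 ∂(haarProbability G) := by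
          refine lintegral_mono fun V => ?_
          simp only [hK]
          rw [← ENNReal.ofReal_one]
          refine ENNReal.ofReal_le_ofReal ?_
          rw [Real.exp_le_one_iff]
          have h0 : 0 ≤ (N : ℝ) - (ρ V).trace.re := by
            rw [sub_re_trace_eq_half_norm_sub_one_sq (hρU _)]; positivity
          nlinarith
      _ = 1 := by rw [lintegral_const, measure_univ, mul_one]
  have hψtop : ∫⁻ V, K V ∂(haarProbability G) ≠ ⊤ := ne_top_of_le_ne_top ENNReal.one_ne_top hψle
  have h0 : 0 ≤ ∫ U, Real.exp (-b * wilsonAction ρ U) ∂π₀ := integral_nonneg fun U => (Real.exp_pos _).le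
  rw [← hScard]
  have := (ENNReal.ofReal_le_iff_le_toReal (ENNReal.pow_ne_top hψtop)).1 hI
  rwa [ENNReal.toReal_pow] at this

/-- **The `SU(2)` reading**: for the defining representation of `SU(2)`, `b > 0` and a four-torus of side `M ≥ 2`,
`∫ exp(−b S) dHaar^E ≤ (3/(b√b))^{3(M⁴ − M³)}` (`…TorusLaplaceSU2.lintegral_exp_neg_mul_two_sub_trace_le`). [folklore] -/
theorem integral_exp_neg_mul_wilsonAction_le_su2 [Fact (1 < M)] {b : ℝ} (hb : 0 < b) :
    ∫ U, Real.exp (-b * wilsonAction (fundamentalRep (Fin 2)) U)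
        ∂(Measure.pi fun _ : Edge 4 M => haarProbability (Matrix.specialUnitaryGroup (Fin 2) ℂ)) ≤
      (3 / (b * Real.sqrt b)) ^ (3 * (M ^ 4 - M ^ 3)) := by
  haveI : SecondCountableTopology (Matrix.specialUnitaryGroup (Fin 2) ℂ) := secondCountableTopology_su2
  have h := integral_exp_neg_mul_wilsonAction_le_pow (M := M) (fundamentalRep (Fin 2)) (continuous_fundamentalRep (Fin 2))
    fundamentalRep_mem_unitaryGroup hb.le
  refine h.trans (pow_le_pow_left₀ ENNReal.toReal_nonneg ?_ _)
  have hψ := lintegral_exp_neg_mul_two_sub_trace_le hb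
  have hN : ∀ V : Matrix.specialUnitaryGroup (Fin 2) ℂ,
      ((2 : ℕ) : ℝ) - (fundamentalRep (Fin 2) V).trace.re = 2 - ((V : Matrix (Fin 2) (Fin 2) ℂ).trace).re := by
    intro V; rw [Literature.MathematicalPhysics.QuantumLattice.fundamentalRep_apply]; norm_num
  simp_rw [hN]
  exact (ENNReal.toReal_mono ENNReal.ofReal_ne_top hψ).trans (by rw [ENNReal.toReal_ofReal (by positivity)])

end Upper

end Summit.QuantumFields.YangMills.Cruxes.UVSeamRec.ClassicalResponse.ThermalFloor

end
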